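import Summits.QuantumFields.BalabanUV.Beta.CombSecondOrderClassBase
import Summits.QuantumFields.BalabanUV.Beta.CombSecondOrderRemainderAn1Scaled
import Summits.QuantumFields.BalabanUV.Beta.SymTablesAn1S2Weighted
import Summits.QuantumFields.BalabanUV.Beta.SymMixedRemainderClass

/-!
# `BalabanUV.Beta.CombSecondOrderClassScaled` — binder row D1, chart (III″) (RULING R-D1-g56-4, W-3 [AN2-G56-W3] programme (S)∕(D5), localisation tail):
# **THE κ-TWIN OF `CombSecondOrderClassBase` §2–§3 AND `CombSecondOrderClassStep` §4** — the `LocStencil₂` class bookkeeping for the κ-literal's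
# second-order table `T2RecOf … (w • symMixFFAt ρ_c Lc) j`, and for its recursive remainder `combR2An1W` (`CombSecondOrderRemainderAn1Scaled`): base and step

HONEST FRAMING (cell contract, verbatim): «discharging `BetaPertH` makes Bałaban's UV stability UNCONDITIONAL — a real constructive-QFT
result; it is NOT the continuum limit and NOT the Clay problem.»  THIS MODULE DISCHARGES NOTHING of `BetaPertH` ∕ row D1.  [folklore] localisation
bookkeeping BY NAME over the resolvent-generic lemmas of the chart-(II) originals (`SymSecondOrderClassBase.locStencil₂_reflDefect`,
`SymSecondOrderClassStep.pkg_of_spr`, `SymSecondOrderSplitLoc` §1∕§5 — leaf-03 g17 ∕ leaf-10 ∕ the OWNER) and the PIN-GENERIC (III′) step lemma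
`CombSecondOrderClassStep.locStencil₂_R2succ_symTablesAn1` (its `hR2succ` right-hand side carries no mixed table, so it is instantiated at the pin `w·cΛ`, not
twinned); 0 sorry, 0 def, 0 `def … : Prop`, nothing cited as a fact, no table VALUE, NO pin value (`cΛ`, `w` parameters), no lock, no `Odd Lc`.
NOT D1, NOT BetaPertH, NOT continuum, NOT Clay.

WHY (W-3 (S)∕(D5); leaf-04 g33 census N-1 §B: `CombSecondOrderClassBase.locStencil₂_T2RecOf_symTablesAn1` hard-codes the unit mixed table): the κ-chain's Z∕N steps
consume `hΔL` (localisation of the split defect), which the (III′) chain gets from the two-class induction of `CombSecondOrderDeltaSep` over this base∕step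
pair.  For the κ-literal the objects are `combR2An1W ∕ combΔAn1W` (recursively DEFINED at the mixed table `w • symMixFFAt ρ_c Lc`, pin `w·cΛ`, remainder
`w • symRMrAn1 Lc cΛ γ`), so the induction is RE-RUN over them; this file is its base and its R2-step, the companion `CombSecondOrderDeltaSepScaled` its
Δ-half and `hΔL`.  The weight is written `w` (the programme's κ; `κ` is a bound bond index here).

WHAT:
* §1 `locStencilFM_smul_symRMrAn1` — the κ-scaled mixed reflection remainder `fun κ u ρ t ↦ w • symRMrAn1 Lc cΛ γ j α κ u ρ t` is a localised
  field–multiplier family (leaf-03 g17's `SymMixedRemainderClass.locStencilFM_symRMrAn1` + `StepJetData.biLoc_smul`, constant `|w|·C`, same rate).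
* §2 `locStencil₂_T2RecOf_symTablesAn1W` — `T2RecOf 3 Lc (GcombSh Lc) (SpureRecOf … (w·cΛ)) (M1Of … (w·cΛ)) Lc⁸ (−Lc¹²∕4) ((8N²)⁻¹•wsym22 N) (symVh₂SAn1 3 Lc)
  (w • symMixFFAt ρ_c Lc) j` is `LocStencil₂`, every level (`SpineRooted.T2RecOf_loc` at leaf-04's (Lmix-w) `SymTablesAn1S2Weighted.smul_symMixFFAt_hmix_ctr`).
* §3 `locStencil₂_combR2An1W_zero` — THE BASE: `combR2An1W Lc N cΛ w γ X2s 0 α` is a `LocStencil₂` family (verbatim route of the (III′) base).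
* §4 `locStencil₂_combR2An1W_succ` — THE R2-STEP: the class of `combR2An1W … (j+1) α` from the level-`j` separation classes of `X2s j α` and `combΔAn1W … j α`
  (`locStencil₂_R2succ_symTablesAn1` at the pin `w·cΛ`, read through `hR2succ_combW`, which is `rfl`).
NOT HERE: the Δ-half of the step and `hΔL` (`CombSecondOrderDeltaSepScaled`); the κ-chain roots; parity ∕ tadpole twins; the (III″) root; any edit of a parent.
HONEST DEPENDENCY (verbatim): «continuum YM on T⁴ ⇐ BetaPertH ∧ nine spine estimates (0/9 proved); BetaPertH ⇐ (D1) ∧ (D4) ∧ CAP+tail;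
G-an2-4 gates asym, D1 and NE2/3/4.»  ABSOLUTE RULE (cell, verbatim): «No internally-minted statement may enter as a cited fact. Every
hypothesis is either kernel-proved in this package or a verbatim quotation of a PUBLISHED theorem with page reference.»
Provenance: β sub-cell, D1 formalisation swarm leaf prover 03 (`b2b-balaban-beta-d1-formalise-leaf-03` gen 50), 2026-08-25 (v1; OFFER O-g50-1 «LOC-TAIL-κ» P2,
zero weight until the row OWNER's word); the text of an2 g36∕37's `CombSecondOrderClassBase` §2–§3 ∕ `CombSecondOrderClassStep` §4 with the (S) substitutions;
an1-lineage tables consumed BY NAME; no existing file touched.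
-/

noncomputable section
noncomputable section

open Finset
open scoped BigOperators
open Literature.MathematicalPhysics.QuantumFieldTheory
open Literature.MathematicalPhysics.QuantumFieldTheory.Balaban1983to89
open Literature.MathematicalPhysics.QuantumFieldTheory.Balaban1983to89.Beta
open B12Sec2to5 (l1 l1_nonneg)
open ExpKernelCalculus (MKer Decays BiLoc VertexFamily)
open PolarizationSign (reflSign)
open KernelReflection (refK)
open ResolventReflection (bref Φ)
open KernelWard (biLoc_add biLoc_sub)
open AveragingContoursRooted (ctr ctrOff ctrOff_mem_box)
open OneStepResolventKernel (Fib LocStencil biLoc_mono)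
open BalabanCompositeJets (LocStencil₂)
open BalabanStepW2 (locStencil₂_smul' locStencil₂_add')
open WilsonVertex2Sym (wsym22)
open Summit.QuantumFields.BalabanUV.Beta.TameKernelCalculus
open Summit.QuantumFields.BalabanUV.Beta.ChartConjugation (conjV conjW)
open Summit.QuantumFields.BalabanUV.Beta.AxialDressingRooted (one_le_of_neZero)
open Summit.QuantumFields.BalabanUV.Beta.BorderedHessian (bhK diagK spr_bhK)
open Summit.QuantumFields.BalabanUV.Beta.SecondOrderBorderGauge (actB)
open Summit.QuantumFields.BalabanUV.Beta.SecondOrderBorderClassKit (locStencil₂_actB locStencil₂_conjW)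
open Summit.QuantumFields.BalabanUV.Beta.CombChartStepJets (GcombSh decays_GcombSh)
open Summit.QuantumFields.BalabanUV.Beta.DshAn1 (Dsh)
open Summit.QuantumFields.BalabanUV.Beta.SpineRooted (M1Of SpureRecOf T2RecOf locStencil_SpureRecOf vertexFamily_M1Of T2RecOf_loc)
open Summit.QuantumFields.BalabanUV.Beta.SymShiftedSpread (bhKStepSh spr_bhKStepSh)
open Summit.QuantumFields.BalabanUV.Beta.RelInvNullShift (spr_add)
open Summit.QuantumFields.BalabanUV.Beta.DshAn1 (Dsh spr_Dsh)
open Summit.QuantumFields.BalabanUV.Beta.E3ContactGenerator (ctGenM)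
open Summit.QuantumFields.BalabanUV.Beta.SymAveragingHessianCounts (symVhSAt symHessFFAt symVhSAt_hV_ctr symHessFFAt_hH_ctr)
open Summit.QuantumFields.BalabanUV.Beta.SymAveragingMixedJetTables (symMixFFAt)
open Summit.QuantumFields.BalabanUV.Beta.SymSecondOrderTablesAn1 (symVh₂SAn1 locStencil₂_symVh₂SAn1 symMixFFAt_hmix_ctr)
open Summit.QuantumFields.BalabanUV.Beta.SymSecondOrderSplitLoc (locStencil_diagK_mul_ctGenM locStencil₂_diagK_ctGenM_mul_ctGenM)
open Summit.QuantumFields.BalabanUV.Beta.CombSecondOrderRemainderAn1Scaled (combR2An1W combΔAn1W hR2succ_combW)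
open Summit.QuantumFields.BalabanUV.Beta.CombSecondOrderClassStep (locStencil₂_R2succ_symTablesAn1)
open Summit.QuantumFields.BalabanUV.Beta.SymTablesAn1S2Weighted (smul_symMixFFAt_hmix_ctr)
open Summit.QuantumFields.BalabanUV.Beta.SymMixedReflectionLetterAn1 (symRMrAn1)
open Summit.QuantumFields.BalabanUV.Beta.SymMixedRemainderClass (locStencilFM_symRMrAn1)
open StepJetData (biLoc_smul)
open SecondOrderResponse (LocStencilFM)
open Summit.QuantumFields.BalabanUV.Beta.SymSecondOrderClassStep (pkg_of_spr)
open Summit.QuantumFields.BalabanUV.Beta.SymSecondOrderClassBase (locStencil₂_reflDefect)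

namespace Summit.QuantumFields.BalabanUV.Beta.CombSecondOrderClassScaled

variable {d : ℕ}

section Literal

variable {Lc : ℕ} [NeZero Lc]

/-! ## §1 The κ-scaled mixed reflection remainder is a localised field–multiplier family -/

/-- [folklore] **(L-RMr-w)**: for every weight `w`, `fun κ u ρ t ↦ w • symRMrAn1 Lc cΛ γ j α κ u ρ t` is `LocStencilFM` at the rate of leaf-03 g17's
`SymMixedRemainderClass.locStencilFM_symRMrAn1`, with constant `|w|·C` (`StepJetData.biLoc_smul`). -/
theorem locStencilFM_smul_symRMrAn1 (w cΛ : ℝ) (γ : ℕ → ℝ) (j : ℕ) (α : Fin 4) :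
    ∃ C δ : ℝ, 0 < δ ∧ LocStencilFM Lc (fun κ u ρ t => w • symRMrAn1 Lc cΛ γ j α κ u ρ t) C δ := by
  obtain ⟨C, δ, hδ, h⟩ := locStencilFM_symRMrAn1 (Lc := Lc) cΛ γ j α
  refine ⟨|w| * C, δ, hδ, fun κ u ρ t => ?_⟩
  have h1 := biLoc_smul (h κ u ρ t) w
  rw [← mul_assoc] at h1
  exact h1

/-! ## §2 The κ-literal's second-order table `T2RecOf … (w • symMixFFAt ρ_c Lc) j` is a `LocStencil₂` family -/

/-- [folklore] **`T2RecOf` OF THE κ-LITERAL IS `LocStencil₂`, EVERY LEVEL** — `SpineRooted.T2RecOf_loc` at the sym suppliers (DG)(LS)(LM)(LB) and leaf-04's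
(Lmix-w) `smul_symMixFFAt_hmix_ctr` for the weighted mixed table; pin `w·cΛ` (no `Odd Lc`, no lock). -/
theorem locStencil₂_T2RecOf_symTablesAn1W (N : ℕ) (cΛ w : ℝ) :
    ∀ j : ℕ, ∃ C δ : ℝ, 0 < δ ∧ LocStencil₂
      (T2RecOf 3 Lc (GcombSh Lc) (SpureRecOf 3 Lc (symVhSAt (ctr 4 Lc) 3 Lc rfl) (symHessFFAt (ctr 4 Lc) Lc) (GcombSh Lc) ((Lc : ℝ) ^ 4) (-((Lc : ℝ) ^ 8 / 2)) (w * cΛ))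
        (M1Of 3 Lc (symHessFFAt (ctr 4 Lc) Lc) (w * cΛ)) ((Lc : ℝ) ^ 8) (-((Lc : ℝ) ^ 12 / 4)) ((8 * (N : ℝ) ^ 2)⁻¹ • wsym22 N) (symVh₂SAn1 3 Lc)
        (w • symMixFFAt (ctr 4 Lc) Lc) j) C δ := by
  have hL1 : 1 ≤ Lc := one_le_of_neZero Lc
  obtain ⟨C1, hH1⟩ := symHessFFAt_hH_ctr (d := 3) hL1 1 zero_le_one
  exact T2RecOf_loc ((Lc : ℝ) ^ 8) (-((Lc : ℝ) ^ 12 / 4)) ((8 * (N : ℝ) ^ 2)⁻¹ • wsym22 N) (symVh₂SAn1 3 Lc) (w • symMixFFAt (ctr 4 Lc) Lc) hL1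
    (decays_GcombSh Lc)
    (locStencil_SpureRecOf (d := 3) hL1 (symVhSAt_hV_ctr (d := 3) hL1) (symHessFFAt_hH_ctr (d := 3) hL1) (decays_GcombSh Lc) _ _ (w * cΛ))
    (fun j => ⟨_, 1, one_pos, vertexFamily_M1Of hH1 (w * cΛ) j⟩) (locStencil₂_symVh₂SAn1 hL1) (smul_symMixFFAt_hmix_ctr hL1 w)

/-! ## §3 THE BASE: `combR2An1W … 0 α` is a `LocStencil₂` family -/

/-- [folklore] **THE BASE OF THE CLASS INDUCTION FOR THE κ-LITERAL**: `combR2An1W Lc N cΛ w γ X2s 0 α` is a `LocStencil₂` family at some positive rate, for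
every `N`, `cΛ`, `w`, `γ`, `X2s`, `α` (the reflection action of the level-0 table, the table, and the level-0 contact family at the pin `w·cΛ` — all
`LocStencil₂` at a common rate; no `Odd Lc`, no lock, no letter; the (III′) base's route verbatim). -/
theorem locStencil₂_combR2An1W_zero (N : ℕ) (cΛ w : ℝ) (γ : ℕ → ℝ)
    (X2s : ℕ → Fin 4 → Fin 4 → (Fin 4 → ℤ) → Fin 4 → (Fin 4 → ℤ) → (Fin 4 → ℤ) → Fib 3 → ℝ) (α : Fin 4) :
    ∃ C δ : ℝ, 0 < δ ∧ LocStencil₂ (combR2An1W Lc N cΛ w γ X2s 0 α) C δ := by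
  have hL1 : 1 ≤ Lc := one_le_of_neZero Lc
  -- the level-0 table
  obtain ⟨CT, δT, hδT, hT⟩ := locStencil₂_T2RecOf_symTablesAn1W (Lc := Lc) N cΛ w 0
  -- the letters of the contact family, at their own rates
  obtain ⟨δM, CM, hδM, hCM, hMd⟩ := pkg_of_spr (spr_bhKStepSh (d := 3) (Lc := Lc) (spr_Dsh hL1) 0)
  obtain ⟨δB, CB, hδB, hCB, hBd⟩ := pkg_of_spr (spr_add (spr_bhK (d := 3) hL1) (spr_Dsh hL1))
  obtain ⟨Cs, δs, hδs, hS⟩ := locStencil_SpureRecOf (d := 3) hL1 (symVhSAt_hV_ctr (d := 3) hL1) (symHessFFAt_hH_ctr (d := 3) hL1)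
    (decays_GcombSh Lc) ((Lc : ℝ) ^ 4) (-((Lc : ℝ) ^ 8 / 2)) (w * cΛ) 0
  have hX := locStencil_diagK_mul_ctGenM hBd hδB.le (γ 0) α Lc
  have hX₂ := locStencil₂_diagK_ctGenM_mul_ctGenM hBd hδB.le (γ 0) (γ 0) α Lc
  -- one common rate
  set m : ℝ := min (min δT δM) (min δs (δB / 3)) with hm_def
  have hm : 0 < m := lt_min (lt_min hδT hδM) (lt_min hδs (by positivity))
  have hmT : m ≤ δT := (min_le_left _ _).trans (min_le_left _ _)
  have hmM : m ≤ δM := (min_le_left _ _).trans (min_le_right _ _)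
  have hms : m ≤ δs := (min_le_right _ _).trans (min_le_left _ _)
  have hmB3 : m ≤ δB / 3 := (min_le_right _ _).trans (min_le_right _ _)
  have hmB2 : m ≤ δB / 2 := hmB3.trans (by linarith)
  have hCs : 0 ≤ Cs := (hS 0 0).nonneg (Sum.inl 0)
  have hTm := hT.mono (m := m) hmT
  have hMm : Decays (bhKStepSh 3 Lc (Dsh Lc) 0) (|CM|) m := decays_of_le hMd hmM
  have hSm : LocStencil (SpureRecOf 3 Lc (symVhSAt (ctr 4 Lc) 3 Lc rfl) (symHessFFAt (ctr 4 Lc) Lc) (GcombSh Lc) ((Lc : ℝ) ^ 4) (-((Lc : ℝ) ^ 8 / 2)) (w * cΛ) 0)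
      Cs m := fun κ u => biLoc_mono (hS κ u) hCs hms
  have hXm : LocStencil (fun κ u => diagK fun p a => γ 0 * ctGenM 3 (bhK Lc + Dsh Lc) α Lc κ u p a)
      (|(|γ 0| * (1 + ((Lc : ℝ) ^ (3 + 1))⁻¹ * CB))|) m := fun κ u => biLoc_of_le (hX κ u) hmB2
  have hX₂m := hX₂.mono (m := m) hmB3
  -- the contact family
  obtain ⟨CW, hW⟩ := locStencil₂_conjW hMm hSm hXm hX₂m hm
  -- assemble at rate m/8
  have h := locStencil₂_reflDefect (d := 3) hL1 α (hTm.mono (m := m / 8) (by linarith)) hW (by positivity)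
  have e : combR2An1W Lc N cΛ w γ X2s 0 α = fun κ u κ' u' =>
      actB Lc α (T2RecOf 3 Lc (GcombSh Lc) (SpureRecOf 3 Lc (symVhSAt (ctr 4 Lc) 3 Lc rfl) (symHessFFAt (ctr 4 Lc) Lc) (GcombSh Lc) ((Lc : ℝ) ^ 4) (-((Lc : ℝ) ^ 8 / 2)) (w * cΛ))
          (M1Of 3 Lc (symHessFFAt (ctr 4 Lc) Lc) (w * cΛ)) ((Lc : ℝ) ^ 8) (-((Lc : ℝ) ^ 12 / 4)) ((8 * (N : ℝ) ^ 2)⁻¹ • wsym22 N) (symVh₂SAn1 3 Lc)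
          (w • symMixFFAt (ctr 4 Lc) Lc) 0) κ u κ' u' -
        T2RecOf 3 Lc (GcombSh Lc) (SpureRecOf 3 Lc (symVhSAt (ctr 4 Lc) 3 Lc rfl) (symHessFFAt (ctr 4 Lc) Lc) (GcombSh Lc) ((Lc : ℝ) ^ 4) (-((Lc : ℝ) ^ 8 / 2)) (w * cΛ))
          (M1Of 3 Lc (symHessFFAt (ctr 4 Lc) Lc) (w * cΛ)) ((Lc : ℝ) ^ 8) (-((Lc : ℝ) ^ 12 / 4)) ((8 * (N : ℝ) ^ 2)⁻¹ • wsym22 N) (symVh₂SAn1 3 Lc)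
          (w • symMixFFAt (ctr 4 Lc) Lc) 0 κ u κ' u' -
        conjW (bhKStepSh 3 Lc (Dsh Lc) 0)
          (SpureRecOf 3 Lc (symVhSAt (ctr 4 Lc) 3 Lc rfl) (symHessFFAt (ctr 4 Lc) Lc) (GcombSh Lc) ((Lc : ℝ) ^ 4) (-((Lc : ℝ) ^ 8 / 2)) (w * cΛ) 0 κ u)
          (SpureRecOf 3 Lc (symVhSAt (ctr 4 Lc) 3 Lc rfl) (symHessFFAt (ctr 4 Lc) Lc) (GcombSh Lc) ((Lc : ℝ) ^ 4) (-((Lc : ℝ) ^ 8 / 2)) (w * cΛ) 0 κ' u')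
          ((fun κ u => diagK fun p a => γ 0 * ctGenM 3 (bhK Lc + Dsh Lc) α Lc κ u p a) κ u)
          ((fun κ u => diagK fun p a => γ 0 * ctGenM 3 (bhK Lc + Dsh Lc) α Lc κ u p a) κ' u')
          ((fun κ u κ' u' => diagK fun p a => (γ 0 * ctGenM 3 (bhK Lc + Dsh Lc) α Lc κ u p a) * (γ 0 * ctGenM 3 (bhK Lc + Dsh Lc) α Lc κ' u' p a)) κ u κ' u') := by
    funext κ u κ' u'; rfl
  rw [e]
  exact ⟨_, m / 8, by positivity, h⟩

/-! ## §4 THE R2-STEP: the class of `combR2An1W … (j+1) α` -/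

/-- [folklore] **THE CLASS OF `combR2An1W … (j+1) α` FROM THE LEVEL-`j` SEPARATION CLASSES OF `X2s j α` AND `combΔAn1W … j α`** — the (III′) step lemma
`CombSecondOrderClassStep.locStencil₂_R2succ_symTablesAn1` (PIN-GENERIC: its right-hand side carries no mixed table) at the pin `w·cΛ` with
`Δ := combΔAn1W …`, read through `CombSecondOrderRemainderAn1Scaled.hR2succ_combW` (`rfl`). -/
theorem locStencil₂_combR2An1W_succ (N : ℕ) (cΛ w : ℝ) (γ : ℕ → ℝ)
    (X2s : ℕ → Fin 4 → Fin 4 → (Fin 4 → ℤ) → Fin 4 → (Fin 4 → ℤ) → (Fin 4 → ℤ) → Fib 3 → ℝ) (j : ℕ) (α : Fin 4)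
    (hX : ∃ C δ : ℝ, 0 < δ ∧ ∀ μ y ν y', BiLoc (diagK (X2s j α μ y ν y')) ((Lc : ℤ) • y) ((Lc : ℤ) • y)
      (C * Real.exp (-δ * l1 ((Lc : ℤ) • y - (Lc : ℤ) • y'))) δ)
    (hΔ : ∃ C δ : ℝ, 0 < δ ∧ ∀ μ y ν y', BiLoc (combΔAn1W Lc N cΛ w γ X2s j α μ y ν y') ((Lc : ℤ) • y) ((Lc : ℤ) • y)
      (C * Real.exp (-δ * l1 ((Lc : ℤ) • y - (Lc : ℤ) • y'))) δ) :
    ∃ C δ : ℝ, 0 < δ ∧ LocStencil₂ (combR2An1W Lc N cΛ w γ X2s (j + 1) α) C δ := by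
  obtain ⟨C, δ, hδ, h⟩ := locStencil₂_R2succ_symTablesAn1 (Lc := Lc) (w * cΛ) γ j α (X2s := X2s) (Δ := combΔAn1W Lc N cΛ w γ X2s) hX hΔ
  refine ⟨C, δ, hδ, fun κ u κ' u' => ?_⟩
  rw [hR2succ_combW]
  exact h κ u κ' u'

end Literal

end Summit.QuantumFields.BalabanUV.Beta.CombSecondOrderClassScaled

end
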